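import Literature.Analysis.FluidPDE.CylindricalGenerator
import Literature.Analysis.FluidPDE.StatisticalSolutionDirac
import HarnessLib

/-!
# Stub `stub_cutoffFlux` of line `cutoff_compactness` (crux stmt-AnomalousDissipation-18402,
  `TameRoughRigidity.TameClosure`)

**Generator bookkeeping for the Galerkin cut-off test.** The cut-off scheme of the line tests the
forced-Euler generator `⟨F₀(v), ·⟩ = (f, ·) + ∫ (v ⊗ v) : ∇(·)` (`Torus.nsGeneratorPairing 0 f v`)
against `Ψ(v) = χ(|P_K v|²/ρ) Φ(v)`, whose differential is the two-term field
`c(v) Φ'(v) + κ(v) P_K v` (`P_K = Torus.fourierTruncate K`, the Fourier truncation to the modes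
`|k| ≤ K`). This file supplies the five elementary tools the assembly consumes:

1. `cutoffFlux_linear` — linearity of `w ↦ ⟨F₀(v), w⟩` on the two-term field
   (`Torus.nsGeneratorPairing_sum_smul` over `Fin 2`; the `P_K v` term is
   `(f, P_K v) + ∫ (v ⊗ v) : ∇P_K v`);
2. `cutoffFlux_cauchySchwarz` — `|(f, P_K v)| ≤ ‖f‖₂ |P_K v|` (the `L²` inner product of the
   classes, `abs_real_inner_le_norm`);
3. `cutoffFlux_exists_inertial_le` — the finite-dimensional (Bernstein) flux bound
   `|∫ (v ⊗ v) : ∇P_K v| ≤ C_K |P_K v| |v|²` with `C_K = 6πK √#{|k| ≤ K}`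
   (`‖D(P_K v)(x) a‖ ≤ ‖a‖ K_K(v)`, `Torus.norm_fderiv_fourierTruncate_apply_le`, and
   `K_K(v) = Σᵢ Σ_{|k|≤K} 2π|kᵢ| ‖v̂(k)‖ ≤ 6πK √N_K |P_K v|` by `|kᵢ| ≤ K`, Cauchy–Schwarz on the
   ball and Parseval for the truncation `Torus.integral_norm_sq_fourierTruncate`);
4. `cutoffFlux_continuous_truncNormSq` — continuity of `v ↦ |P_K v|²` on `H` (a finite sum of
   squares of the continuous Fourier coefficients `Torus.continuous_mFourierCoeff_complexify_coe`);
5. `cutoffFlux_pythagoras` — `∫ ‖v − P_K v‖² = |v|² − |P_K v|²` (`P_K` is an orthogonal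
   projection: `∫ ⟪v, P_K v⟫ = ∫ ‖P_K v‖²` by `Torus.integral_inner_fourierTruncate_eq`).

All five are folklore (Foias–Manley–Rosa–Temam 2001, Ch. IV App. B.1, (B.10)–(B.11), the
Galerkin bookkeeping of the two-dimensional energy equation, here in `d = 3` where only the
finite-dimensional constant `C_K` — no dimension-free Bernstein/Ladyzhenskaya input — is claimed).

## References

* C. Foias, O. Manley, R. Rosa, R. Temam, *Navier–Stokes Equations and Turbulence* (CUP 2001),
  Ch. IV §1.1 (1.7)–(1.11), App. B.1 (B.10)–(B.11). [FoiasManleyRosaTemam2001]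
-/

set_option linter.dupNamespace false

noncomputable section

namespace Summit.AnomalousDissipation.AnomalousDissipation.Theorems.TameRoughRigidity.TameClosure

open MeasureTheory Filter Topology UnitAddTorus
open scoped InnerProductSpace RealInnerProductSpace ENNReal NNReal
open Literature.Analysis.FunctionSpaces Literature.Analysis.FluidPDE

/-- Local notation: real vector fields on `T³`. -/
local notation "Vec3" => (UnitAddTorus (Fin 3)) → (EuclideanSpace ℝ (Fin 3))
/-- Local notation: `L²(T³; ℝ³)`. -/
local notation "L2" => (Lp (EuclideanSpace ℝ (Fin 3)) 2 (volume : Measure (UnitAddTorus (Fin 3))))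
/-- Local notation: the energy space `H`. -/
local notation "H3" => (Torus.energySpace (Fin 3))

/-! ### (1) Linearity of the tested generator on the two-term field -/

/-- **Linearity of the forced-Euler generator on `a Φ'(v) + b P_K v`**:
`⟨F₀(v), a Φ'(v) + b P_K v⟩ = a ⟨F₀(v), Φ'(v)⟩ + b ((f, P_K v) + ∫ (v ⊗ v) : ∇P_K v)` for a smooth
force `f` (both fields are smooth, so every summand of `nsGeneratorPairing` is a genuine integral;
at `ν = 0` the Stokes term of the `P_K v` summand is `0 · (v, ΔP_K v) = 0`). [folklore] -/
theorem cutoffFlux_linear (f : Vec3) (hf : Torus.IsSmooth f) (Φ : Torus.CylindricalTest (Fin 3))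
    (K : ℕ) (a b : ℝ) (v : H3) :
    Torus.nsGeneratorPairing 0 f v
        (fun x => a • Φ.grad v x + b • Torus.fourierTruncate K (((v : L2)) : Vec3) x) =
      a * Torus.nsGeneratorPairing 0 f v (Φ.grad v) +
        b * ((∫ x, ⟪f x, Torus.fourierTruncate K (((v : L2)) : Vec3) x⟫_ℝ) +
          Torus.inertialPairing (v : L2) (Torus.fourierTruncate K (((v : L2)) : Vec3))) := by
  set w : Vec3 := Torus.fourierTruncate K (((v : L2)) : Vec3) with hw
  have hws : Torus.IsSmooth w := Torus.isSmooth_fourierTruncate K _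
  have hgs : Torus.IsSmooth (Φ.grad v) := Torus.CylindricalTest.isSmooth_grad_holds Φ v
  -- the two-term combination as a `Fin 2`-indexed sum (`Torus.nsGeneratorPairing_sum_smul`)
  have hsum := Torus.nsGeneratorPairing_sum_smul 0 hf.integrable v Finset.univ ![a, b]
    (g := ![Φ.grad v, w]) (fun i _ => by
      fin_cases i
      · exact hgs
      · exact hws)
  simp only [Fin.sum_univ_two, Matrix.cons_val_zero, Matrix.cons_val_one] at hsum
  rw [hsum]
  simp only [Torus.nsGeneratorPairing, zero_mul, add_zero]

/-! ### (2) Cauchy–Schwarz for the forcing term -/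

/-- **Cauchy–Schwarz**: `|(f, P_K v)| ≤ ‖f‖₂ |P_K v|` for `f ∈ L²` (the integral is the `L²` inner
product of the classes of `f` and `P_K v`; `|P_K v|² = Torus.truncNormSq K v`). [folklore] -/
theorem cutoffFlux_cauchySchwarz (f : Vec3) (hf : MemLp f 2 volume) (K : ℕ) (v : H3) :
    |∫ x, ⟪f x, Torus.fourierTruncate K (((v : L2)) : Vec3) x⟫_ℝ| ≤
      Real.sqrt (∫ x, ‖f x‖ ^ 2) * Real.sqrt (Torus.truncNormSq K v) := by
  rw [Torus.truncNormSq]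
  set w : Vec3 := Torus.fourierTruncate K (((v : L2)) : Vec3) with hw_def
  have hw : MemLp w 2 volume := Torus.memLp_fourierTruncate K _ 2
  have h1 : ∫ x, ⟪f x, w x⟫_ℝ = ⟪hf.toLp f, hw.toLp w⟫_ℝ := by
    rw [MeasureTheory.L2.inner_def]
    refine integral_congr_ae ?_
    filter_upwards [hf.coeFn_toLp, hw.coeFn_toLp] with x hx hx'
    rw [hx, hx']
  rw [h1, ← Torus.norm_toLp_eq_sqrt hf, ← Torus.norm_toLp_eq_sqrt hw]
  exact abs_real_inner_le_norm _ _

/-! ### (3) The finite-dimensional Bernstein flux bound -/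

/-- **Bernstein bound for the derivative constant of a truncation** (any dimension, here `d = 3`):
`K_K(v) = Σᵢ Σ_{|k|≤K} 2π|kᵢ| ‖v̂(k)‖ ≤ 6πK √#{|k| ≤ K} · |P_K v|`, by `|kᵢ| ≤ K`, Cauchy–Schwarz on
the finite ball and Parseval `∫ ‖P_K v‖² = Σ_{|k|≤K} ‖v̂(k)‖²`. [folklore] -/
theorem cutoffFlux_truncDerivBound_le (K : ℕ) (v : H3) :
    Torus.truncDerivBound K (((v : L2)) : Vec3) ≤
      (3 * (2 * Real.pi * K) * Real.sqrt ((Torus.freqBall (d := Fin 3) K).card)) *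
        Real.sqrt (Torus.truncNormSq K v) := by
  rw [Torus.truncNormSq]
  set u : Vec3 := ((v : L2) : Vec3) with hu
  have hint : Integrable u volume := (Lp.memLp (v : L2)).integrable one_le_two
  set c : (Fin 3 → ℤ) → ℝ := fun k => ‖mFourierCoeff (EuclideanSpace.complexify ∘ u) k‖ with hc
  set S : ℝ := ∑ k ∈ Torus.freqBall K, c k with hS_def
  -- Cauchy–Schwarz on the ball and Parseval for the truncation
  have hS : S ≤ Real.sqrt ((Torus.freqBall (d := Fin 3) K).card) *
      Real.sqrt (∫ y, ‖Torus.fourierTruncate K u y‖ ^ 2) := by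
    have h := Real.sum_mul_le_sqrt_mul_sqrt (Torus.freqBall K) (fun _ => (1 : ℝ)) c
    simp only [one_mul, one_pow, Finset.sum_const, nsmul_eq_mul, mul_one] at h
    rw [Torus.integral_norm_sq_fourierTruncate hint]
    exact h
  -- `|kᵢ| ≤ K` on the ball
  have h1 : Torus.truncDerivBound K u ≤ ∑ _i : Fin 3, 2 * Real.pi * K * S := by
    unfold Torus.truncDerivBound
    refine Finset.sum_le_sum fun i _ => ?_
    rw [Finset.mul_sum]
    refine Finset.sum_le_sum fun k hk => ?_
    -- `|kᵢ| ≤ |k| ≤ K`, as in the proof of `Torus.truncDerivBound_sq_le_integral`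
    have hki : |(k i : ℝ)| ≤ K := by
      refine (Torus.abs_apply_le_sqrt_freqNormSq k i).trans ?_
      refine (Real.sqrt_le_sqrt (Torus.mem_freqBall.1 hk)).trans_eq ?_
      rw [Real.sqrt_sq (Nat.cast_nonneg _)]
    have hc0 : 0 ≤ c k := norm_nonneg _
    calc 2 * Real.pi * |(k i : ℝ)| * ‖mFourierCoeff (EuclideanSpace.complexify ∘ u) k‖
        = (2 * Real.pi) * (|(k i : ℝ)| * c k) := by ring
      _ ≤ (2 * Real.pi) * ((K : ℝ) * c k) :=
          mul_le_mul_of_nonneg_left (mul_le_mul_of_nonneg_right hki hc0) (by positivity)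
      _ = 2 * Real.pi * K * c k := by ring
  simp only [Finset.sum_const, Finset.card_univ, Fintype.card_fin, nsmul_eq_mul, Nat.cast_ofNat] at h1
  calc Torus.truncDerivBound K u ≤ 3 * (2 * Real.pi * K * S) := h1
    _ = 3 * (2 * Real.pi * K) * S := by ring
    _ ≤ 3 * (2 * Real.pi * K) * (Real.sqrt ((Torus.freqBall (d := Fin 3) K).card) *
          Real.sqrt (∫ y, ‖Torus.fourierTruncate K u y‖ ^ 2)) :=
        mul_le_mul_of_nonneg_left hS (by positivity)
    _ = _ := by ring

/-- **The inertial flux against a truncation is controlled by the derivative constant**: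
`|∫ (v ⊗ v) : ∇P_K v| ≤ K_K(v) |v|²` (`‖D(P_K v)(x) v(x)‖ ≤ ‖v(x)‖ K_K(v)` pointwise,
`Torus.norm_fderiv_fourierTruncate_apply_le`, and `∫ ‖v‖² = |v|²`). [folklore] -/
theorem cutoffFlux_abs_inertialPairing_le (K : ℕ) (v : H3) :
    |Torus.inertialPairing (v : L2) (Torus.fourierTruncate K (((v : L2)) : Vec3))| ≤
      Torus.truncDerivBound K (((v : L2)) : Vec3) * ‖v‖ ^ 2 := by
  rw [Torus.inertialPairing, ← Real.norm_eq_abs, Submodule.coe_norm, ← Torus.integral_norm_sq_coe_eq,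
    ← integral_const_mul]
  set u : Vec3 := ((v : L2) : Vec3) with hu
  set w : Vec3 := Torus.fourierTruncate K u with hw
  have hmem : MemLp u 2 volume := Lp.memLp (v : L2)
  have hDb : ∀ x, ‖Torus.fderiv w x (u x)‖ ≤ ‖u x‖ * Torus.truncDerivBound K u := fun x =>
    Torus.norm_fderiv_fourierTruncate_apply_le K u x (u x)
  refine norm_integral_le_of_norm_le ((hmem.integrable_norm_pow two_ne_zero).const_mul _)
    (ae_of_all _ fun x => ?_)
  refine (norm_inner_le_norm _ _).trans ?_
  calc ‖Torus.fderiv w x (u x)‖ * ‖u x‖ ≤ (‖u x‖ * Torus.truncDerivBound K u) * ‖u x‖ :=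
        mul_le_mul_of_nonneg_right (hDb x) (norm_nonneg _)
    _ = Torus.truncDerivBound K u * ‖u x‖ ^ 2 := by ring

/-- **The finite-dimensional Bernstein flux bound**: for every order `K` there is `C_K ≥ 0`
(here `C_K = 6πK √#{|k| ≤ K}`) with `|∫ (v ⊗ v) : ∇P_K v| ≤ C_K |P_K v| |v|²` on `H`. No growth rate
in `K` is claimed. [folklore] -/
theorem cutoffFlux_exists_inertial_le (K : ℕ) : ∃ C : ℝ, 0 ≤ C ∧ ∀ v : H3,
    |Torus.inertialPairing (v : L2) (Torus.fourierTruncate K (((v : L2)) : Vec3))| ≤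
      C * Real.sqrt (Torus.truncNormSq K v) * ‖v‖ ^ 2 := by
  refine ⟨3 * (2 * Real.pi * K) * Real.sqrt ((Torus.freqBall (d := Fin 3) K).card), by positivity,
    fun v => ?_⟩
  refine (cutoffFlux_abs_inertialPairing_le K v).trans ?_
  exact mul_le_mul_of_nonneg_right (cutoffFlux_truncDerivBound_le K v) (sq_nonneg _)

/-! ### (4) Continuity of `v ↦ |P_K v|²` -/

/-- **`v ↦ |P_K v|²` is continuous on `H`**: by Parseval for the truncation it is the finite sum
`Σ_{|k|≤K} ‖v̂(k)‖²` of squares of norms of Fourier coefficients, each of which is a continuous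
(`1`-Lipschitz) functional of the `L²` class. [folklore] -/
theorem cutoffFlux_continuous_truncNormSq (K : ℕ) :
    Continuous fun v : H3 => Torus.truncNormSq K v := by
  have h : (fun v : H3 => Torus.truncNormSq K v) = fun v : H3 =>
      ∑ k ∈ Torus.freqBall K,
        ‖mFourierCoeff (EuclideanSpace.complexify ∘ (((v : L2)) : Vec3)) k‖ ^ 2 := by
    funext v
    exact Torus.integral_norm_sq_fourierTruncate ((Lp.memLp (v : L2)).integrable one_le_two) K
  rw [h]
  exact continuous_finsetSum _ fun k _ =>
    (((Torus.continuous_mFourierCoeff_complexify_coe k).comp continuous_subtype_val).norm).pow 2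

/-! ### (5) Pythagoras for the truncation -/

/-- **Pythagoras**: `∫ ‖v − P_K v‖² = |v|² − |P_K v|²` for `v ∈ H` — `P_K` is the orthogonal
projection onto the modes `|k| ≤ K`, so `∫ ⟪v, P_K v⟫ = ∫ ‖P_K v‖²`
(`Torus.integral_inner_fourierTruncate_eq`: the truncation is invisible to band-limited fields).
[folklore] -/
theorem cutoffFlux_pythagoras (K : ℕ) (v : H3) :
    ∫ x, ‖(((v : L2)) : Vec3) x - Torus.fourierTruncate K (((v : L2)) : Vec3) x‖ ^ 2 =
      ‖v‖ ^ 2 - Torus.truncNormSq K v := by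
  rw [Torus.truncNormSq, Submodule.coe_norm, ← Torus.integral_norm_sq_coe_eq]
  set u : Vec3 := ((v : L2) : Vec3) with hu
  have hmem : MemLp u 2 volume := Lp.memLp (v : L2)
  have hint : Integrable u volume := hmem.integrable one_le_two
  set w : Vec3 := Torus.fourierTruncate K u with hw
  have hwmem : MemLp w 2 volume := Torus.memLp_fourierTruncate K u 2
  have hws : Torus.IsSmooth w := Torus.isSmooth_fourierTruncate K u
  have h1 : Integrable (fun x => ‖u x‖ ^ 2) volume := hmem.integrable_norm_pow two_ne_zero
  have h2 : Integrable (fun x => ⟪u x, w x⟫_ℝ) volume :=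
    Torus.integrable_inner_of_continuous hint hws.continuous
  have h3 : Integrable (fun x => ‖w x‖ ^ 2) volume := hwmem.integrable_norm_pow two_ne_zero
  -- `∫ ⟪v, P_K v⟫ = ∫ ⟪P_K v, P_K v⟫`: `P_K v` is band-limited to the ball
  have hproj : ∫ x, ⟪u x, w x⟫_ℝ = ∫ x, ‖w x‖ ^ 2 := by
    rw [← Torus.integral_inner_fourierTruncate_eq hmem hwmem (N := K) fun k hk => by
      rw [hw, Torus.mFourierCoeff_fourierTruncate hint, if_neg hk]]
    exact integral_congr_ae (ae_of_all _ fun x => real_inner_self_eq_norm_sq _)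
  have h12 : Integrable (fun x => ‖u x‖ ^ 2 - 2 * ⟪u x, w x⟫_ℝ) volume := h1.sub (h2.const_mul 2)
  simp_rw [norm_sub_sq_real]
  rw [integral_add h12 h3, integral_sub h1 (h2.const_mul 2), integral_const_mul, hproj]
  ring

/-! ### The stub -/

/-- **S2b `stub_cutoffFlux`** — GENERATOR BOOKKEEPING FOR THE CUT-OFF TEST, the conjunction of the
five tools above: (1) linearity of the forced-Euler generator on `a Φ'(v) + b P_K v`;
(2) Cauchy–Schwarz `|(f, P_K v)| ≤ ‖f‖₂ |P_K v|`; (3) the finite-dimensional Bernstein flux bound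
`|∫ (v ⊗ v) : ∇P_K v| ≤ C_K |P_K v| |v|²`; (4) continuity of `v ↦ |P_K v|²` on `H`;
(5) Pythagoras `∫ ‖v − P_K v‖² = |v|² − |P_K v|²`.
[FoiasManleyRosaTemam2001, Ch. IV App. B.1 (B.10)–(B.11)] -/
theorem stub_cutoffFlux :
    (∀ (f : Vec3), Torus.IsSmooth f → ∀ (Φ : Torus.CylindricalTest (Fin 3)) (K : ℕ) (a b : ℝ) (v : H3),
      Torus.nsGeneratorPairing 0 f v
          (fun x => a • Φ.grad v x + b • Torus.fourierTruncate K (((v : L2)) : Vec3) x) =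
        a * Torus.nsGeneratorPairing 0 f v (Φ.grad v) +
          b * ((∫ x, ⟪f x, Torus.fourierTruncate K (((v : L2)) : Vec3) x⟫_ℝ) +
            Torus.inertialPairing (v : L2) (Torus.fourierTruncate K (((v : L2)) : Vec3)))) ∧
    (∀ (f : Vec3), MemLp f 2 volume → ∀ (K : ℕ) (v : H3),
      |∫ x, ⟪f x, Torus.fourierTruncate K (((v : L2)) : Vec3) x⟫_ℝ| ≤
        Real.sqrt (∫ x, ‖f x‖ ^ 2) * Real.sqrt (Torus.truncNormSq K v)) ∧
    (∀ K : ℕ, ∃ C : ℝ, 0 ≤ C ∧ ∀ v : H3,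
      |Torus.inertialPairing (v : L2) (Torus.fourierTruncate K (((v : L2)) : Vec3))| ≤
        C * Real.sqrt (Torus.truncNormSq K v) * ‖v‖ ^ 2) ∧
    (∀ K : ℕ, Continuous fun v : H3 => Torus.truncNormSq K v) ∧
    (∀ (K : ℕ) (v : H3),
      ∫ x, ‖(((v : L2)) : Vec3) x - Torus.fourierTruncate K (((v : L2)) : Vec3) x‖ ^ 2 =
        ‖v‖ ^ 2 - Torus.truncNormSq K v) :=
  ⟨cutoffFlux_linear, cutoffFlux_cauchySchwarz, cutoffFlux_exists_inertial_le,
    cutoffFlux_continuous_truncNormSq, cutoffFlux_pythagoras⟩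

end Summit.AnomalousDissipation.AnomalousDissipation.Theorems.TameRoughRigidity.TameClosure
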